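import Mathlib
import HarnessLib
import Summits.NavierStokesRegularity.NavierStokesRegularity.Theorems.PoloidalWindowDoorPoloidalWindowRigiditySparseEnergySourceFreeDatum
import Summits.NavierStokesRegularity.NavierStokesRegularity.Theorems.PoloidalWindowDoorPoloidalWindowRigidityThmARelocation

/-!
# Route `PoloidalWindowDoor`, crux `PoloidalWindowRigidity` (stmt-19708) / item `LrcModEntire` (stmt-20428), line `sparse_energy` —
# THE (TH) COLUMN ON K-SPARSE PROFILES: the hyperbolic stub and the twisting (TH) residue from a SOURCE-FREE local emptiness statement

Seat ns-poloidal-K2-p2 g9 (successor of the interim LEAD-of-record on 19708; file `--supports`).  Rung R2 of line `sparse_energy`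
(`…SparseEnergySourceFree.pressureDatum_eq_zero`, p614454; consumer form `…SparseEnergySourceFreeDatum.exists_localTHDatum_sourceFree`,
p615536) says: on a profile of the route's Type-I class whose scale-invariant energy is bounded (`∫_{B_R(a)} |v(t₀)|² ≤ K·R`, the
conclusion of stub S1 `stub_scaledEnergy`), the local (TH)∩twisting datum `(μ, A, U, p₀)` of K2-p3's `exists_localTHDatum` comes with a
VANISHING pressure datum, `A ≡ 0` on the window.  This file cashes that in on the (TH) column of the crux:

* `stub_hyperbolicTHSparse_of_localEmptyHypSF` — the `mixed_type` / `z_shock` stub `stub_hyperbolicTH` ON K-SPARSE PROFILES (its statement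
  verbatim with the energy bound inserted after poloidality) follows from the SOURCE-FREE hyperbolic local emptiness statement
  `hemptyHypSF` := K2-p2 g6's `hemptyHyp` (`…TwistingTHLocalHyp`: «no real-analytic `(u, μ(t,z), A(t,z))` on an open `U ∋ p₀` with the four
  local (TH) laws and E, twist `≠ 0`, `μ ∉ {0,1}`, `∂_zμ ≠ 0`, `μ < 0` at `p₀`») with ONE MORE hypothesis before `False`:
  `∀ p ∈ U, A p.1 (p.2 2) = 0`.  Proof: `exists_localTHDatum_sourceFree` gives the datum with `A ≡ 0`; on a hyperbolic window the slope
  at the base point is negative (`∂₂v₀∂₀v₂ + ∂₂v₁∂₁v₂ = μ·|∇ₕv₂|² < 0 ⇒ μ(p₀) < 0`, K2-p2 g6's Step 12′ in three lines); feed `hemptyHypSF`.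
* `twistingTHSparse_regular_of_localEmptyHypSF` — `hemptyHypSF` ⇒ lrc_jet v5's `stub_twisting` ∩ (TH) ON K-SPARSE PROFILES (the (TH)
  half of line `sparse_energy`'s residue S2 `stub_twistingSparse`, which carries the energy bound as a hypothesis), by cstrat's Theorem A
  relocation `…ThmARelocation.twistingTH_regular_of_hyperbolicTH` (stated per profile, so the energy bound rides along).

So for K-sparse profiles the registered local target of the (TH) column may be replaced by the SOURCE-FREE statement `hemptyHypSF`: the
free analytic function `A(t,z)` is GONE from E in the original frame.  (For the engines / the rest-frame normal forms: after the Galilean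
boost `u(p₀) = 0` of `…TwistingTHLocalGalilean.galilean_E` the datum becomes the EXPLICIT `A′ = c₂(∂ₜμ′ − ∂_z²μ′) − (c₂²/2)∂_zμ′` in the
BOOSTED slope `μ′`, one real scalar `c₂ = u₂(p₀)`; note the sign of the `c₂²` term in boosted variables.)

WHAT THIS IS NOT: not a proof of the stub, not the crux, and not a claim about Navier–Stokes regularity — two reductions, conditional in
use on the line's open stub S1 (the K-bound is a HYPOTHESIS); bears_on LADDER-NS N0 via crux 19708 / item 20428.
-/

noncomputable section

-- the summit and its single sub-problem share the name (CONVENTIONS §1), as in every Theorems file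
set_option linter.dupNamespace false

namespace Summit.NavierStokesRegularity.NavierStokesRegularity.Theorems.PoloidalWindowDoorLrcModEntireTwistingTHSparse

open Set Function Filter Topology Metric
open scoped RealInnerProductSpace InnerProductSpace Laplacian ENNReal
open Literature.Analysis Literature.Analysis.FluidPDE
open Summit.NavierStokesRegularity.NavierStokesRegularity.Theorems.PoloidalWindowDoorPoloidalWindowRigiditySparseEnergySourceFreeDatum
open Summit.NavierStokesRegularity.NavierStokesRegularity.Theorems.PoloidalWindowDoorPoloidalWindowRigidityThmARelocation

/-- **`stub_hyperbolicTH` ON K-SPARSE PROFILES ⇐ `hemptyHypSF`.**  The `mixed_type` stub `stub_hyperbolicTH` with the bounded scale-invariant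
energy of line `sparse_energy` as an extra hypothesis follows from the SOURCE-FREE hyperbolic local (TH)∩twisting emptiness statement
(`hemptyHyp` + `∀ p ∈ U, A = 0`). [folklore] -/
theorem stub_hyperbolicTHSparse_of_localEmptyHypSF
    (hemptyHypSF : ∀ (u : ℝ → EuclideanSpace ℝ (Fin 3) → EuclideanSpace ℝ (Fin 3)) (μ A : ℝ → ℝ → ℝ)
      (U : Set (ℝ × EuclideanSpace ℝ (Fin 3))) (p₀ : ℝ × EuclideanSpace ℝ (Fin 3)),
      IsOpen U → p₀ ∈ U →
      AnalyticOnNhd ℝ (Function.uncurry u) U →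
      (∀ p ∈ U, AnalyticAt ℝ (Function.uncurry μ) (p.1, p.2 2)) →
      (∀ p ∈ U, AnalyticAt ℝ (Function.uncurry A) (p.1, p.2 2)) →
      (∀ p ∈ U, fderiv ℝ (u p.1) p.2 (EuclideanSpace.single 0 1) 1 = fderiv ℝ (u p.1) p.2 (EuclideanSpace.single 1 1) 0) →
      (∀ p ∈ U, fderiv ℝ (u p.1) p.2 (EuclideanSpace.single 0 1) 0 + fderiv ℝ (u p.1) p.2 (EuclideanSpace.single 1 1) 1 +
        fderiv ℝ (u p.1) p.2 (EuclideanSpace.single 2 1) 2 = 0) →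
      (∀ p ∈ U, ∀ b : Fin 3, b ≠ 2 →
        fderiv ℝ (u p.1) p.2 (EuclideanSpace.single 2 1) b =
          μ p.1 (p.2 2) * fderiv ℝ (u p.1) p.2 (EuclideanSpace.single b 1) 2) →
      (∀ p ∈ U,
        (1 - μ p.1 (p.2 2)) *
            (deriv (fun s => u s p.2 2) p.1 + fderiv ℝ (fun y => u p.1 y 2) p.2 (u p.1 p.2)
              - Δ (fun y => u p.1 y 2) p.2) =
          A p.1 (p.2 2) + (deriv (fun s => μ s (p.2 2)) p.1 - deriv (deriv (μ p.1)) (p.2 2)) * u p.1 p.2 2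
            + deriv (μ p.1) (p.2 2) / 2 * u p.1 p.2 2 ^ 2
            - 2 * deriv (μ p.1) (p.2 2) * fderiv ℝ (u p.1) p.2 (EuclideanSpace.single 2 1) 2) →
      fderiv ℝ (fun y => fderiv ℝ (u p₀.1) y (EuclideanSpace.single 2 1) 2) p₀.2 (EuclideanSpace.single 0 1) *
            fderiv ℝ (u p₀.1) p₀.2 (EuclideanSpace.single 1 1) 2 -
          fderiv ℝ (fun y => fderiv ℝ (u p₀.1) y (EuclideanSpace.single 2 1) 2) p₀.2 (EuclideanSpace.single 1 1) *
            fderiv ℝ (u p₀.1) p₀.2 (EuclideanSpace.single 0 1) 2 ≠ 0 →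
      μ p₀.1 (p₀.2 2) ≠ 0 → μ p₀.1 (p₀.2 2) ≠ 1 → deriv (μ p₀.1) (p₀.2 2) ≠ 0 →
      μ p₀.1 (p₀.2 2) < 0 →
      (∀ p ∈ U, A p.1 (p.2 2) = 0) → False) :
    ∀ (C : ℝ) (v : ℝ → EuclideanSpace ℝ (Fin 3) → EuclideanSpace ℝ (Fin 3)),
      Literature.Analysis.FluidPDE.HasTypeITimeDecay C v →
      ContinuousOn (Function.uncurry v) (Set.Iio (0 : ℝ) ×ˢ Set.univ) →
      (∀ s t : ℝ, s < t → t < 0 → ∀ x, v t x =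
        Literature.Analysis.UnboundedOperators.heatExtension (v s) (t - s) x -
          Literature.Analysis.FluidPDE.oseenDuhamel 1 s v v t x) →
      (∀ t < 0, Literature.Analysis.FluidPDE.VectorCalculus.IsDivFree (v t)) →
      (∀ s < 0, ∀ y, ⟪Literature.Analysis.FluidPDE.curl (v s) y, EuclideanSpace.single 2 1⟫_ℝ = 0) →
      ∀ K : ℝ, 0 ≤ K →
        (∀ t₀ : ℝ, t₀ < 0 → ∀ (a : EuclideanSpace ℝ (Fin 3)) (R : ℝ), 0 < R →
          (∫⁻ x in Metric.ball a R, ENNReal.ofReal (‖v t₀ x‖ ^ 2)) ≤ ENNReal.ofReal (K * R)) →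
      ∀ W : Set (ℝ × EuclideanSpace ℝ (Fin 3)), IsOpen W → W.Nonempty → W ⊆ Set.Iio (0 : ℝ) ×ˢ Set.univ →
        (∀ z ∈ W, Literature.Analysis.FluidPDE.curl (v z.1) z.2 ≠ 0 ∧
          (fderiv ℝ (v z.1) z.2 (EuclideanSpace.single 0 1) 2 ≠ 0 ∨ fderiv ℝ (v z.1) z.2 (EuclideanSpace.single 1 1) 2 ≠ 0) ∧
          (fderiv ℝ (v z.1) z.2 (EuclideanSpace.single 2 1) 0 ≠ 0 ∨ fderiv ℝ (v z.1) z.2 (EuclideanSpace.single 2 1) 1 ≠ 0)) →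
        (∀ m : ℝ → ℝ, ∀ W₁ : Set (ℝ × EuclideanSpace ℝ (Fin 3)), W₁ ⊆ W → IsOpen W₁ → W₁.Nonempty →
          ∃ z ∈ W₁, ∃ b : Fin 3, b ≠ 2 ∧
            fderiv ℝ (v z.1) z.2 (EuclideanSpace.single 2 1) b ≠
              m z.1 * fderiv ℝ (v z.1) z.2 (EuclideanSpace.single b 1) 2) →
        (∀ z ∈ W,
          fderiv ℝ (fun x => fderiv ℝ (v z.1) x (EuclideanSpace.single 2 1) 2) z.2 (EuclideanSpace.single 0 1) *
              fderiv ℝ (v z.1) z.2 (EuclideanSpace.single 1 1) 2 -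
            fderiv ℝ (fun x => fderiv ℝ (v z.1) x (EuclideanSpace.single 2 1) 2) z.2 (EuclideanSpace.single 1 1) *
              fderiv ℝ (v z.1) z.2 (EuclideanSpace.single 0 1) 2 ≠ 0) →
        (∀ z ∈ W,
          fderiv ℝ (v z.1) z.2 (EuclideanSpace.single 2 1) 0 * fderiv ℝ (v z.1) z.2 (EuclideanSpace.single 0 1) 2 +
            fderiv ℝ (v z.1) z.2 (EuclideanSpace.single 2 1) 1 * fderiv ℝ (v z.1) z.2 (EuclideanSpace.single 1 1) 2 < 0) →
        (∃ m : ℝ → ℝ → ℝ, ∀ z ∈ W, ∀ b : Fin 3, b ≠ 2 →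
          fderiv ℝ (v z.1) z.2 (EuclideanSpace.single 2 1) b =
            m z.1 (z.2 2) * fderiv ℝ (v z.1) z.2 (EuclideanSpace.single b 1) 2) →
        ¬ Literature.Analysis.FluidPDE.IsBackwardSingularPoint v 0 := by
  intro C v hrate hcont hmild hdiv hpol K hK0 hK W hW hWne hWs hnd hpin htw hhyp hTH _hsing
  obtain ⟨m, hm⟩ := hTH
  obtain ⟨μ, A, U, p₀, hU, hp₀, hUW, hvU, hμU, hAU, hpolU, hdivU, hshU, hEU, htwU, hμ0, hμ1, hμz, hA0⟩ :=
    exists_localTHDatum_sourceFree hrate hcont hmild hdiv hpol hK0 hK hW hWne hWs hnd hpin htw hm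
  -- Step 12′: on a hyperbolic window the slope at the base point is negative
  have hneg : μ p₀.1 (p₀.2 2) < 0 := by
    have hh := hhyp p₀ (hUW hp₀)
    rw [hshU p₀ hp₀ 0 (by decide), hshU p₀ hp₀ 1 (by decide)] at hh
    by_contra hge
    push Not at hge
    nlinarith [mul_nonneg hge (sq_nonneg (fderiv ℝ (v p₀.1) p₀.2 (EuclideanSpace.single 0 1) 2)),
      mul_nonneg hge (sq_nonneg (fderiv ℝ (v p₀.1) p₀.2 (EuclideanSpace.single 1 1) 2))]
  exact hemptyHypSF v μ A U p₀ hU hp₀ hvU hμU hAU hpolU hdivU hshU hEU htwU hμ0 hμ1 hμz hneg hA0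

/-- **lrc_jet v5's `stub_twisting` ∩ (TH) ON K-SPARSE PROFILES ⇐ `hemptyHypSF`** — the (TH) half of line `sparse_energy`'s residue S2, by
Theorem A relocation (`…ThmARelocation.twistingTH_regular_of_hyperbolicTH`: on (TH) every slice is hyperbolic somewhere; the statement is per
profile, so the energy bound rides along). [folklore] -/
theorem twistingTHSparse_regular_of_localEmptyHypSF
    (hemptyHypSF : ∀ (u : ℝ → EuclideanSpace ℝ (Fin 3) → EuclideanSpace ℝ (Fin 3)) (μ A : ℝ → ℝ → ℝ)
      (U : Set (ℝ × EuclideanSpace ℝ (Fin 3))) (p₀ : ℝ × EuclideanSpace ℝ (Fin 3)),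
      IsOpen U → p₀ ∈ U →
      AnalyticOnNhd ℝ (Function.uncurry u) U →
      (∀ p ∈ U, AnalyticAt ℝ (Function.uncurry μ) (p.1, p.2 2)) →
      (∀ p ∈ U, AnalyticAt ℝ (Function.uncurry A) (p.1, p.2 2)) →
      (∀ p ∈ U, fderiv ℝ (u p.1) p.2 (EuclideanSpace.single 0 1) 1 = fderiv ℝ (u p.1) p.2 (EuclideanSpace.single 1 1) 0) →
      (∀ p ∈ U, fderiv ℝ (u p.1) p.2 (EuclideanSpace.single 0 1) 0 + fderiv ℝ (u p.1) p.2 (EuclideanSpace.single 1 1) 1 +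
        fderiv ℝ (u p.1) p.2 (EuclideanSpace.single 2 1) 2 = 0) →
      (∀ p ∈ U, ∀ b : Fin 3, b ≠ 2 →
        fderiv ℝ (u p.1) p.2 (EuclideanSpace.single 2 1) b =
          μ p.1 (p.2 2) * fderiv ℝ (u p.1) p.2 (EuclideanSpace.single b 1) 2) →
      (∀ p ∈ U,
        (1 - μ p.1 (p.2 2)) *
            (deriv (fun s => u s p.2 2) p.1 + fderiv ℝ (fun y => u p.1 y 2) p.2 (u p.1 p.2)
              - Δ (fun y => u p.1 y 2) p.2) =
          A p.1 (p.2 2) + (deriv (fun s => μ s (p.2 2)) p.1 - deriv (deriv (μ p.1)) (p.2 2)) * u p.1 p.2 2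
            + deriv (μ p.1) (p.2 2) / 2 * u p.1 p.2 2 ^ 2
            - 2 * deriv (μ p.1) (p.2 2) * fderiv ℝ (u p.1) p.2 (EuclideanSpace.single 2 1) 2) →
      fderiv ℝ (fun y => fderiv ℝ (u p₀.1) y (EuclideanSpace.single 2 1) 2) p₀.2 (EuclideanSpace.single 0 1) *
            fderiv ℝ (u p₀.1) p₀.2 (EuclideanSpace.single 1 1) 2 -
          fderiv ℝ (fun y => fderiv ℝ (u p₀.1) y (EuclideanSpace.single 2 1) 2) p₀.2 (EuclideanSpace.single 1 1) *
            fderiv ℝ (u p₀.1) p₀.2 (EuclideanSpace.single 0 1) 2 ≠ 0 →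
      μ p₀.1 (p₀.2 2) ≠ 0 → μ p₀.1 (p₀.2 2) ≠ 1 → deriv (μ p₀.1) (p₀.2 2) ≠ 0 →
      μ p₀.1 (p₀.2 2) < 0 →
      (∀ p ∈ U, A p.1 (p.2 2) = 0) → False) :
    ∀ (C : ℝ) (v : ℝ → EuclideanSpace ℝ (Fin 3) → EuclideanSpace ℝ (Fin 3)),
      Literature.Analysis.FluidPDE.HasTypeITimeDecay C v →
      ContinuousOn (Function.uncurry v) (Set.Iio (0 : ℝ) ×ˢ Set.univ) →
      (∀ s t : ℝ, s < t → t < 0 → ∀ x, v t x =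
        Literature.Analysis.UnboundedOperators.heatExtension (v s) (t - s) x -
          Literature.Analysis.FluidPDE.oseenDuhamel 1 s v v t x) →
      (∀ t < 0, Literature.Analysis.FluidPDE.VectorCalculus.IsDivFree (v t)) →
      (∀ s < 0, ∀ y, ⟪Literature.Analysis.FluidPDE.curl (v s) y, EuclideanSpace.single 2 1⟫_ℝ = 0) →
      ∀ K : ℝ, 0 ≤ K →
        (∀ t₀ : ℝ, t₀ < 0 → ∀ (a : EuclideanSpace ℝ (Fin 3)) (R : ℝ), 0 < R →
          (∫⁻ x in Metric.ball a R, ENNReal.ofReal (‖v t₀ x‖ ^ 2)) ≤ ENNReal.ofReal (K * R)) →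
      ∀ W : Set (ℝ × EuclideanSpace ℝ (Fin 3)), IsOpen W → W.Nonempty → W ⊆ Set.Iio (0 : ℝ) ×ˢ Set.univ →
        (∀ z ∈ W, Literature.Analysis.FluidPDE.curl (v z.1) z.2 ≠ 0 ∧
          (fderiv ℝ (v z.1) z.2 (EuclideanSpace.single 0 1) 2 ≠ 0 ∨ fderiv ℝ (v z.1) z.2 (EuclideanSpace.single 1 1) 2 ≠ 0) ∧
          (fderiv ℝ (v z.1) z.2 (EuclideanSpace.single 2 1) 0 ≠ 0 ∨ fderiv ℝ (v z.1) z.2 (EuclideanSpace.single 2 1) 1 ≠ 0)) →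
        (∀ m : ℝ → ℝ, ∀ W₁ : Set (ℝ × EuclideanSpace ℝ (Fin 3)), W₁ ⊆ W → IsOpen W₁ → W₁.Nonempty →
          ∃ z ∈ W₁, ∃ b : Fin 3, b ≠ 2 ∧
            fderiv ℝ (v z.1) z.2 (EuclideanSpace.single 2 1) b ≠
              m z.1 * fderiv ℝ (v z.1) z.2 (EuclideanSpace.single b 1) 2) →
        (∀ z ∈ W,
          fderiv ℝ (fun x => fderiv ℝ (v z.1) x (EuclideanSpace.single 2 1) 2) z.2 (EuclideanSpace.single 0 1) *
              fderiv ℝ (v z.1) z.2 (EuclideanSpace.single 1 1) 2 -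
            fderiv ℝ (fun x => fderiv ℝ (v z.1) x (EuclideanSpace.single 2 1) 2) z.2 (EuclideanSpace.single 1 1) *
              fderiv ℝ (v z.1) z.2 (EuclideanSpace.single 0 1) 2 ≠ 0) →
        (∃ m : ℝ → ℝ → ℝ, ∀ z ∈ W, ∀ b : Fin 3, b ≠ 2 →
          fderiv ℝ (v z.1) z.2 (EuclideanSpace.single 2 1) b =
            m z.1 (z.2 2) * fderiv ℝ (v z.1) z.2 (EuclideanSpace.single b 1) 2) →
        ¬ Literature.Analysis.FluidPDE.IsBackwardSingularPoint v 0 := by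
  intro C v hrate hcont hmild hdiv hpol K hK0 hK W hW hWne hWs hnd hpin htw hTH
  exact twistingTH_regular_of_hyperbolicTH C v hrate hcont hmild hdiv
    (fun W' hW' hW'ne hW's hnd' hpin' htw' hhyp' hTH' =>
      stub_hyperbolicTHSparse_of_localEmptyHypSF hemptyHypSF C v hrate hcont hmild hdiv hpol K hK0 hK W' hW' hW'ne hW's hnd' hpin'
        htw' hhyp' hTH')
    W hW hWne hWs hnd hpin htw hTH

end Summit.NavierStokesRegularity.NavierStokesRegularity.Theorems.PoloidalWindowDoorLrcModEntireTwistingTHSparse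

end
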